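import Summits.SmoothPoincare4.SmoothPoincare4.Theorems.DottedCircleRasmussenDcrGapHelperHandlebodyChartModelHandlesOfData
import Summits.SmoothPoincare4.SmoothPoincare4.Theorems.DottedCircleRasmussenDcrGapHelperHandlebodyChartModelHandlesPhaseAux
import Summits.SmoothPoincare4.SmoothPoincare4.Theorems.DottedCircleRasmussenDcrGapHelperHandlebodyChartModelHandlesBaseBall

/-!
# Helper `helper_handlebodyChart_modelHandles` (M3: handle structure of the model dotted handlebody `D_k`)
# of line `mk_friends` for crux `DcrGap` — phase data from lifts of the angles about the holes
(item stmt-SmoothPoincare4-16128, route route-SmoothPoincare4-DottedCircleRasmussen)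

**Registered piece `helper_handlebodyChart_modelHandles_phaseOfLifts` of the model lemma M3** (part 3 of
the split of the data stub `helper_handlebodyChart_modelHandles_data`).  The phase clause of the data stub
asks, for every twist vector `m` and radius `ρ < 3a/2`, for an exponent `ε` and a smooth real function `Θ`
on a neighbourhood `N'` of `B̄(c, ρ) ∪ ⋃ⱼ h j (T)`, invariant under the rotations of the `w`-plane, with
`e^{iΘ} u_ε(z) = 1` on the ball and `e^{iΘ(h j p)} u_ε(z(h j p)) = e^{2πi m_j χ(p₀ + 1/2)}` along tube `j`
(`u_ε(z) = Π_l u(z - c_l)^{ε_l}`, `u(v) = v/|v|`, `χ = Real.smoothTransition`).  Here this is derived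
ABSTRACTLY from the static data of the charts (smooth injective immersions `h j` of an open `W ⊇ T` into
`D_k` with pairwise disjoint images, entering the ball `B̄(c, 3a/2) ⊆ D_k` radially), their equivariance,
and **lifts**: for all `j, l` a smooth rotation-invariant `Λ_l^j` on `W` with `e^{iΛ_l^j(p)} = u(z(h j p) - c_l)`,
equal on the two ends `|p₀| ≥ 1/2` to the ball branch `β_l(z) = arg((z - c_l) \overline{(z_c - c_l)}) + arg(z_c - c_l)`
(`z_c = z(c)`), plus `2π` on the end `p₀ > 0` when `l = j` (core `j` winds once about hole `j` and not
about the other holes).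

Proof (`ModelHandles.phase_of_lifts`).  Take `ε = m`, `ρ < ρ₁ < 3a/2`, a rotation-invariant open box
`T ⊆ W' ⊆ W` (compactness), `N' = B(c, ρ₁) ∪ ⋃ⱼ h j (W')`, and
`Θ = 2π m_j χ(p₀ + 1/2) - Σ_l m_l Λ_l^j(p)` at the points `h j p`, `p ∈ W'` (well defined: the charts are
injective with disjoint images), `Θ = -Σ_l m_l β_l(z)` elsewhere.  On `B(c, ρ₁)` the two recipes agree (a
point `h j p` of the ball has `|p₀| > 1/2`, where the end formula of the lifts and `χ ∈ {0, 1}` apply), so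
`Θ` is the smooth ball recipe there (`β_l` is smooth near the ball, which is seen from `c_l` within a
half-plane); near a tube point `Θ` is the tube recipe composed with a local inverse of `h j` (inverse
function theorem), hence smooth, and `h j (W')` is open.  Invariance: the rotations permute the tube points
(equivariance, `W'` invariant, `Λ` invariant) and fix `z`.  The two identities are then one-line
computations with `e^{iΛ_l^j} = u(z - c_l)` and `e^{iβ_l} = u(z - c_l)`.

No definitions, no named facts, no `sorry`.  References: R. Kirby, *The Topology of 4-Manifolds*,
LNM 1374 (1989), Ch. I §2 [Kirby1989].
-/

-- the prescribed namespace `Summit.<P>.<Sub>.…` duplicates `SmoothPoincare4` (P = Sub)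
set_option linter.dupNamespace false
set_option linter.style.longLine false
noncomputable section

open scoped Manifold ContDiff Topology
open Function Set Metric Filter
open Literature.Topology.FourManifolds Literature.Topology.FourManifolds.MMSW
open Literature.AlgebraicTopology.Homotopy.HopfFibration

namespace Summit.SmoothPoincare4.SmoothPoincare4.Theorems.DcrGap.MkFriends

namespace ModelHandles

/-! ## The phase data from the lifts -/

/-- **Phase data of the handle charts from lifts of the angles about the holes** (see the module
docstring): with `ε = m`, the function equal to `2π m_j χ(p₀ + 1/2) - Σ_l m_l Λ_l^j(p)` at the tube points
`h j p` (`p` in an invariant box `T ⊆ W' ⊆ W`) and to `-Σ_l m_l β_l(z)` elsewhere is smooth on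
`B(c, ρ₁) ∪ ⋃ⱼ h j (W')` (`ρ < ρ₁ < 3a/2`), rotation invariant, and satisfies the two phase identities.
[folklore] -/
theorem phase_of_lifts (k : ℕ) (c : EuclideanSpace ℝ (Fin 4)) (a : ℝ) (W : Set (EuclideanSpace ℝ (Fin 4)))
    (h : Fin k → EuclideanSpace ℝ (Fin 4) → EuclideanSpace ℝ (Fin 4))
    (ha : 0 < a) (hcD : closedBall c (3 * a / 2) ⊆ modelHandlebody k) (hWo : IsOpen W)
    (hTW : {p : EuclideanSpace ℝ (Fin 4) | |p 0| ≤ 1 ∧ (p 1) ^ 2 + (p 2) ^ 2 + (p 3) ^ 2 ≤ 1} ⊆ W)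
    (hh : ∀ j, ContDiffOn ℝ ∞ (h j) W ∧ InjOn (h j) W ∧ (∀ p ∈ W, Injective (fderiv ℝ (h j) p)) ∧
      MapsTo (h j) W (modelHandlebody k))
    (hdisj : ∀ j l, j ≠ l → ∀ p ∈ W, ∀ q ∈ W, h j p ≠ h l q)
    (hfar : ∀ j, ∀ p ∈ W, |p 0| ≤ 1 / 2 → 3 * a / 2 ≤ dist (h j p) c)
    (hequiv : ∀ j (β : ℝ), ∀ p ∈ W, h j (!₂[p 0, p 1, Real.cos β * p 2 - Real.sin β * p 3,
      Real.sin β * p 2 + Real.cos β * p 3]) = fibreRot (fun _ => Complex.exp ((β : ℂ) * Complex.I)) (h j p))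
    (hlift : ∀ j l, ∃ Λ : EuclideanSpace ℝ (Fin 4) → ℝ, ContDiffOn ℝ ∞ Λ W ∧
      (∀ p ∈ W, Complex.exp ((Λ p : ℂ) * Complex.I) =
        (zC (h j p) - holeCentre k l) / (((‖zC (h j p) - holeCentre k l‖ : ℝ)) : ℂ)) ∧
      (∀ (β : ℝ), ∀ p ∈ W, !₂[p 0, p 1, Real.cos β * p 2 - Real.sin β * p 3, Real.sin β * p 2 + Real.cos β * p 3] ∈ W →
        Λ (!₂[p 0, p 1, Real.cos β * p 2 - Real.sin β * p 3, Real.sin β * p 2 + Real.cos β * p 3]) = Λ p) ∧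
      (∀ p ∈ W, 1 / 2 ≤ |p 0| → Λ p = Complex.arg ((zC (h j p) - holeCentre k l) *
        (starRingEnd ℂ) (zC c - holeCentre k l)) + Complex.arg (zC c - holeCentre k l) +
        (if j = l ∧ 0 < p 0 then 2 * Real.pi else 0))) :
    ∀ (m : Fin k → ℤ) (ρ : ℝ), ρ < 3 * a / 2 → ∃ (ε : Fin k → ℤ) (N' : Set (EuclideanSpace ℝ (Fin 4)))
      (Θ : EuclideanSpace ℝ (Fin 4) → ℝ), IsOpen N' ∧ closedBall c ρ ⊆ N' ∧
      (∀ j, h j '' {p : EuclideanSpace ℝ (Fin 4) | |p 0| ≤ 1 ∧ (p 1) ^ 2 + (p 2) ^ 2 + (p 3) ^ 2 ≤ 1} ⊆ N') ∧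
      ContDiffOn ℝ ∞ Θ N' ∧ (∀ v : ℂ, ‖v‖ = 1 → ∀ y ∈ N', Θ (fibreRot (fun _ => v) y) = Θ y) ∧
      (∀ y ∈ N', dist y c ≤ ρ → Complex.exp ((Θ y : ℂ) * Complex.I) *
        ∏ l : Fin k, ((zC y - holeCentre k l) / (((‖zC y - holeCentre k l‖ : ℝ)) : ℂ)) ^ (ε l) = 1) ∧
      (∀ j, ∀ p ∈ W, h j p ∈ N' → Complex.exp ((Θ (h j p) : ℂ) * Complex.I) *
        ∏ l : Fin k, ((zC (h j p) - holeCentre k l) / (((‖zC (h j p) - holeCentre k l‖ : ℝ)) : ℂ)) ^ (ε l) =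
        Complex.exp (((2 * Real.pi * (m j : ℝ) * Real.smoothTransition (p 0 + 1 / 2) : ℝ) : ℂ) * Complex.I)) := by
  classical
  intro m ρ hρ
  choose Λ hΛs hΛexp hΛinv hΛend using hlift
  -- an intermediate radius and the box
  set ρ₁ : ℝ := (ρ + 3 * a / 2) / 2 with hρ₁
  have hρρ₁ : ρ < ρ₁ := by rw [hρ₁]; linarith
  have hρ₁a : ρ₁ < 3 * a / 2 := by rw [hρ₁]; linarith
  obtain ⟨η, hη, hboxW⟩ := exists_box_subset hWo hTW
  set W' : Set (EuclideanSpace ℝ (Fin 4)) :=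
    {p | |p 0| < 1 + η ∧ (p 1) ^ 2 + (p 2) ^ 2 + (p 3) ^ 2 < 1 + η} with hW'
  have hW'W : W' ⊆ W := hboxW
  have hW'o : IsOpen W' := by
    simp only [hW', Set.setOf_and]
    exact (isOpen_lt (by fun_prop : Continuous fun p : EuclideanSpace ℝ (Fin 4) => |p 0|)
      continuous_const).inter (isOpen_lt (by fun_prop : Continuous fun p : EuclideanSpace ℝ (Fin 4) =>
        (p 1) ^ 2 + (p 2) ^ 2 + (p 3) ^ 2) continuous_const)
  have hTW' : {p : EuclideanSpace ℝ (Fin 4) | |p 0| ≤ 1 ∧ (p 1) ^ 2 + (p 2) ^ 2 + (p 3) ^ 2 ≤ 1} ⊆ W' :=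
    fun p hp => ⟨by linarith [hp.1], by linarith [hp.2]⟩
  have hW'rot : ∀ (β : ℝ), ∀ p ∈ W', (!₂[p 0, p 1, Real.cos β * p 2 - Real.sin β * p 3,
      Real.sin β * p 2 + Real.cos β * p 3] : EuclideanSpace ℝ (Fin 4)) ∈ W' := by
    intro β p hp
    refine ⟨by simpa using hp.1, ?_⟩
    have h2 : ((!₂[p 0, p 1, Real.cos β * p 2 - Real.sin β * p 3, Real.sin β * p 2 + Real.cos β * p 3] :
        EuclideanSpace ℝ (Fin 4)) 1) ^ 2 + ((!₂[p 0, p 1, Real.cos β * p 2 - Real.sin β * p 3,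
        Real.sin β * p 2 + Real.cos β * p 3] : EuclideanSpace ℝ (Fin 4)) 2) ^ 2 +
        ((!₂[p 0, p 1, Real.cos β * p 2 - Real.sin β * p 3, Real.sin β * p 2 + Real.cos β * p 3] :
        EuclideanSpace ℝ (Fin 4)) 3) ^ 2 = (p 1) ^ 2 + (p 2) ^ 2 + (p 3) ^ 2 := by
      simp
      nlinarith [Real.cos_sq_add_sin_sq β]
    show _ < 1 + η
    rw [h2]; exact hp.2
  -- the hole centres are seen from the ball within a half-plane
  have hcl : ∀ l, 3 * a / 2 < ‖zC c - holeCentre k l‖ := by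
    intro l
    by_contra hle
    push Not at hle
    set y : EuclideanSpace ℝ (Fin 4) := ofZW (holeCentre k l) (wC c) with hy
    have hzy : zC y = holeCentre k l := by simp [hy]
    have hwy : wC y = wC c := by simp [hy]
    have hdist : dist y c = ‖zC c - holeCentre k l‖ := by
      have hsq := normSq_zC_sub_add y c
      rw [hzy, hwy, sub_self, map_zero, add_zero] at hsq
      rw [dist_eq_norm]
      have h1 : ‖y - c‖ ^ 2 = ‖zC c - holeCentre k l‖ ^ 2 := by
        rw [← hsq, Complex.normSq_eq_norm_sq, norm_sub_rev]
      exact (pow_left_inj₀ (norm_nonneg _) (norm_nonneg _) two_ne_zero).1 h1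
    have hyD : y ∈ modelHandlebody k := hcD (mem_closedBall.2 (by rw [hdist]; exact hle))
    have h1 := hyD.1 l
    rw [holeTerm_eq_normSq, hzy, sub_self, map_zero] at h1
    linarith
  have hcl0 : ∀ l, zC c - holeCentre k l ≠ 0 := fun l h0 => by
    have := hcl l; rw [h0, norm_zero] at this; linarith
  -- recipes
  set B : Fin k → ℂ → ℝ := fun l z => Complex.arg ((z - holeCentre k l) * (starRingEnd ℂ) (zC c - holeCentre k l)) +
    Complex.arg (zC c - holeCentre k l) with hB
  set Bal : EuclideanSpace ℝ (Fin 4) → ℝ := fun y => -∑ l, (m l : ℝ) * B l (zC y) with hBal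
  set Tf : Fin k → EuclideanSpace ℝ (Fin 4) → ℝ := fun j p =>
    2 * Real.pi * (m j : ℝ) * Real.smoothTransition (p 0 + 1 / 2) - ∑ l, (m l : ℝ) * Λ j l p with hTf
  set Θ : EuclideanSpace ℝ (Fin 4) → ℝ := fun y =>
    if hy : ∃ j p, p ∈ W' ∧ h j p = y then Tf hy.choose hy.choose_spec.choose else Bal y with hΘ
  -- uniqueness of the tube representation, and the values of `Θ`
  have huniq : ∀ j p, p ∈ W → ∀ j' p', p' ∈ W → h j' p' = h j p → j' = j ∧ p' = p := by
    intro j p hp j' p' hp' he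
    have hjj : j' = j := by
      by_contra hne
      exact hdisj j' j hne p' hp' p hp he
    subst hjj
    exact ⟨rfl, (hh j').2.1 hp' hp he⟩
  have hΘtube : ∀ j, ∀ p ∈ W', Θ (h j p) = Tf j p := by
    intro j p hp
    have hy : ∃ j' p', p' ∈ W' ∧ h j' p' = h j p := ⟨j, p, hp, rfl⟩
    simp only [hΘ, dif_pos hy]
    obtain ⟨h1, h2⟩ := huniq j p (hW'W hp) hy.choose hy.choose_spec.choose
      (hW'W hy.choose_spec.choose_spec.1) hy.choose_spec.choose_spec.2
    have : ∀ j' p', j' = j → p' = p → Tf j' p' = Tf j p := by rintro _ _ rfl rfl; rfl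
    exact this _ _ h1 h2
  have hΘnot : ∀ y, (¬ ∃ j p, p ∈ W' ∧ h j p = y) → Θ y = Bal y := fun y hy => by
    simp only [hΘ, dif_neg hy]
  -- the tube recipe agrees with the ball recipe near the ball
  have hTfBal : ∀ j, ∀ p ∈ W, dist (h j p) c < 3 * a / 2 → Tf j p = Bal (h j p) := by
    intro j p hp hd
    have h12 : 1 / 2 < |p 0| := by
      by_contra hle; push Not at hle
      linarith [hfar j p hp hle]
    have hend : ∀ l, Λ j l p = B l (zC (h j p)) + (if j = l ∧ 0 < p 0 then 2 * Real.pi else 0) :=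
      fun l => hΛend j l p hp h12.le
    simp only [hTf, hBal, hend]
    rcases lt_or_gt_of_ne (show p 0 ≠ 0 by intro h0; rw [h0, abs_zero] at h12; linarith) with hneg | hpos
    · have hp' : p 0 < -(1 / 2) := by rw [abs_of_neg hneg] at h12; linarith
      have hχ : Real.smoothTransition (p 0 + 1 / 2) = 0 :=
        Real.smoothTransition.zero_of_nonpos (by linarith)
      have hite : ∀ l, (if j = l ∧ 0 < p 0 then 2 * Real.pi else 0) = 0 :=
        fun l => if_neg fun hc => by linarith [hc.2]
      simp only [hχ, hite, add_zero, mul_zero, zero_sub]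
    · have hχ : Real.smoothTransition (p 0 + 1 / 2) = 1 :=
        Real.smoothTransition.one_of_one_le (by rw [abs_of_pos hpos] at h12; linarith)
      have hsum : ∑ l, (m l : ℝ) * (B l (zC (h j p)) + if j = l ∧ 0 < p 0 then 2 * Real.pi else 0) =
          ∑ l, (m l : ℝ) * B l (zC (h j p)) + (m j : ℝ) * (2 * Real.pi) := by
        simp only [hpos, and_true, mul_add, Finset.sum_add_distrib, mul_ite, mul_zero]
        rw [Finset.sum_ite_eq Finset.univ j]
        simp
      rw [hsum, hχ]
      ring
  -- `Θ` is the ball recipe on the ball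
  have hΘball : ∀ y, dist y c < 3 * a / 2 → Θ y = Bal y := by
    intro y hy
    by_cases hty : ∃ j p, p ∈ W' ∧ h j p = y
    · obtain ⟨j, p, hp, rfl⟩ := hty
      rw [hΘtube j p hp, hTfBal j p (hW'W hp) hy]
    · exact hΘnot y hty
  -- `Θ` is the tube recipe at all tube points of `N'`
  set N' : Set (EuclideanSpace ℝ (Fin 4)) := ball c ρ₁ ∪ ⋃ j, h j '' W' with hN'
  have hΘtube' : ∀ j, ∀ p ∈ W, h j p ∈ N' → Θ (h j p) = Tf j p := by
    intro j p hp hN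
    by_cases hty : ∃ j' p', p' ∈ W' ∧ h j' p' = h j p
    · obtain ⟨j', p', hp', he⟩ := hty
      obtain ⟨rfl, rfl⟩ := huniq j p hp j' p' (hW'W hp') he
      exact hΘtube j' p' hp'
    · rcases hN with hb | htube
      · rw [hΘnot _ hty, hTfBal j p hp (lt_trans (mem_ball.1 hb) hρ₁a)]
      · exact absurd (by
          obtain ⟨j', hj'⟩ := mem_iUnion.1 htube
          obtain ⟨p', hp', he⟩ := hj'
          exact ⟨j', p', hp', he⟩) hty
  -- unit vectors and the branches
  have hzyc : ∀ y, ∀ l, dist y c < 3 * a / 2 → ‖zC y - zC c‖ < ‖zC c - holeCentre k l‖ := fun y l hy =>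
    lt_of_le_of_lt ((norm_zC_sub_le y c).trans (dist_eq_norm y c).symm.le) (hy.trans (hcl l))
  have hzne : ∀ y, ∀ l, dist y c < 3 * a / 2 → zC y - holeCentre k l ≠ 0 := by
    intro y l hy h0
    have h1 := hzyc y l hy
    have : zC y = holeCentre k l := sub_eq_zero.1 h0
    rw [this, norm_sub_rev] at h1
    exact lt_irrefl _ h1
  have hBexp : ∀ y, ∀ l, dist y c < 3 * a / 2 →
      (zC y - holeCentre k l) / (((‖zC y - holeCentre k l‖ : ℝ)) : ℂ) =
        Complex.exp (((B l (zC y) : ℝ) : ℂ) * Complex.I) := fun y l hy =>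
    unit_eq_exp_ballBranch (hzne y l hy) (hcl0 l)
  -- the identity on the ball
  have hidBal : ∀ y, dist y c < 3 * a / 2 → Complex.exp ((Bal y : ℂ) * Complex.I) *
      ∏ l : Fin k, ((zC y - holeCentre k l) / (((‖zC y - holeCentre k l‖ : ℝ)) : ℂ)) ^ (m l) = 1 := by
    intro y hy
    have hprod : ∏ l : Fin k, ((zC y - holeCentre k l) / (((‖zC y - holeCentre k l‖ : ℝ)) : ℂ)) ^ (m l) =
        Complex.exp (((∑ l, (m l : ℝ) * B l (zC y) : ℝ) : ℂ) * Complex.I) := by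
      push_cast
      rw [Finset.sum_mul, Complex.exp_sum]
      refine Finset.prod_congr rfl fun l _ => ?_
      rw [hBexp y l hy, ← Complex.exp_int_mul]
      ring_nf
    rw [hprod, ← Complex.exp_add, hBal]
    push_cast
    ring_nf
    exact Complex.exp_zero
  -- the identity along the tubes
  have hidTf : ∀ j, ∀ p ∈ W, Complex.exp ((Tf j p : ℂ) * Complex.I) *
      ∏ l : Fin k, ((zC (h j p) - holeCentre k l) / (((‖zC (h j p) - holeCentre k l‖ : ℝ)) : ℂ)) ^ (m l) =
      Complex.exp (((2 * Real.pi * (m j : ℝ) * Real.smoothTransition (p 0 + 1 / 2) : ℝ) : ℂ) * Complex.I) := by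
    intro j p hp
    have hprod : ∏ l : Fin k, ((zC (h j p) - holeCentre k l) / (((‖zC (h j p) - holeCentre k l‖ : ℝ)) : ℂ)) ^ (m l) =
        Complex.exp (((∑ l, (m l : ℝ) * Λ j l p : ℝ) : ℂ) * Complex.I) := by
      push_cast
      rw [Finset.sum_mul, Complex.exp_sum]
      refine Finset.prod_congr rfl fun l _ => ?_
      rw [← hΛexp j l p hp, ← Complex.exp_int_mul]
      ring_nf
    rw [hprod, ← Complex.exp_add, hTf]
    push_cast
    ring_nf
  -- local inverses at tube points (inverse function theorem)
  have hIFT : ∀ j, ∀ p₀ ∈ W', h j '' W' ∈ 𝓝 (h j p₀) ∧ ∃ g : EuclideanSpace ℝ (Fin 4) → EuclideanSpace ℝ (Fin 4),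
      ContDiffAt ℝ ∞ g (h j p₀) ∧ g (h j p₀) = p₀ ∧ ∀ᶠ y in 𝓝 (h j p₀), h j (g y) = y ∧ g y ∈ W' := by
    intro j p₀ hp₀
    have hcd : ContDiffAt ℝ ∞ (h j) p₀ := (hh j).1.contDiffAt (hWo.mem_nhds (hW'W hp₀))
    set f' := Literature.Topology.FourManifolds.fderivEquivOfInjective (h j) p₀ ((hh j).2.2.1 p₀ (hW'W hp₀))
      with hf'def
    have hf' : HasFDerivAt (h j) (f' : EuclideanSpace ℝ (Fin 4) →L[ℝ] EuclideanSpace ℝ (Fin 4)) p₀ := by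
      rw [hf'def, Literature.Topology.FourManifolds.coe_fderivEquivOfInjective]
      exact (hcd.differentiableAt (by simp)).hasFDerivAt
    have hS : HasStrictFDerivAt (h j) (f' : EuclideanSpace ℝ (Fin 4) →L[ℝ] EuclideanSpace ℝ (Fin 4)) p₀ :=
      hcd.hasStrictFDerivAt' hf' (by simp)
    refine ⟨?_, hS.localInverse (h j) f' p₀, ?_, hS.localInverse_apply_image, ?_⟩
    · rw [← hS.map_nhds_eq_of_equiv]
      exact Filter.image_mem_map (hW'o.mem_nhds hp₀)
    · exact hcd.to_localInverse hf' (by simp)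
    · filter_upwards [hS.eventually_right_inverse,
        hS.localInverse_tendsto.eventually_mem (hW'o.mem_nhds hp₀)] with y hy hy'
      exact ⟨hy, hy'⟩
  -- smoothness of the recipes
  have hTfs : ∀ j, ∀ p ∈ W, ContDiffAt ℝ ∞ (Tf j) p := by
    intro j p hp
    simp only [hTf]
    refine ContDiffAt.sub ?_ (ContDiffAt.sum fun l _ => contDiffAt_const.mul ((hΛs j l).contDiffAt (hWo.mem_nhds hp)))
    refine contDiffAt_const.mul ?_
    exact Real.smoothTransition.contDiffAt.comp p ((contDiffAt_euclidean.1 contDiffAt_id (0 : Fin 4)).add contDiffAt_const)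
  have hBals : ∀ y, dist y c < 3 * a / 2 → ContDiffAt ℝ ∞ Bal y := by
    intro y hy
    simp only [hBal]
    refine ContDiffAt.neg (ContDiffAt.sum fun l _ => contDiffAt_const.mul ?_)
    exact (contDiffAt_ballBranch (hzyc y l hy)).comp y contDiff_zC.contDiffAt
  -- conclusion
  refine ⟨m, N', Θ, ?_, ?_, fun j => ?_, ?_, ?_, ?_, ?_⟩
  · -- open
    refine isOpen_ball.union (isOpen_iUnion fun j => isOpen_iff_mem_nhds.2 ?_)
    rintro y ⟨p₀, hp₀, rfl⟩
    exact (hIFT j p₀ hp₀).1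
  · exact (closedBall_subset_ball hρρ₁).trans subset_union_left
  · exact (image_mono hTW').trans ((subset_iUnion (fun j => h j '' W') j).trans subset_union_right)
  · -- smooth
    intro y₀ hy₀
    suffices hat : ContDiffAt ℝ ∞ Θ y₀ from hat.contDiffWithinAt
    rcases hy₀ with hb | htube
    · have hev : Θ =ᶠ[𝓝 y₀] Bal := by
        filter_upwards [isOpen_ball.mem_nhds hb] with y hy
        exact hΘball y (lt_trans (mem_ball.1 hy) hρ₁a)
      exact (hBals y₀ (lt_trans (mem_ball.1 hb) hρ₁a)).congr_of_eventuallyEq hev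
    · obtain ⟨j, hj⟩ := mem_iUnion.1 htube
      obtain ⟨p₀, hp₀, rfl⟩ := hj
      obtain ⟨-, g, hgs, hg0, hev⟩ := hIFT j p₀ hp₀
      have hev' : Θ =ᶠ[𝓝 (h j p₀)] fun y => Tf j (g y) := by
        filter_upwards [hev] with y hy
        have := hΘtube j (g y) hy.2
        rw [hy.1] at this
        exact this
      refine ContDiffAt.congr_of_eventuallyEq ?_ hev'
      have hT : ContDiffAt ℝ ∞ (Tf j) (g (h j p₀)) := by rw [hg0]; exact hTfs j p₀ (hW'W hp₀)
      exact hT.comp (h j p₀) hgs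
  · -- invariance
    intro v hv y hy
    have hvexp : Complex.exp (((Complex.arg v : ℝ) : ℂ) * Complex.I) = v := by
      have := Complex.norm_mul_exp_arg_mul_I v
      rw [hv] at this
      simpa using this
    by_cases hty : ∃ j p, p ∈ W' ∧ h j p = y
    · obtain ⟨j, p, hp, rfl⟩ := hty
      have hrot : fibreRot (fun _ => v) (h j p) = h j (!₂[p 0, p 1, Real.cos (Complex.arg v) * p 2 -
          Real.sin (Complex.arg v) * p 3, Real.sin (Complex.arg v) * p 2 + Real.cos (Complex.arg v) * p 3]) := by
        rw [hequiv j _ p (hW'W hp), hvexp]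
      have hT : Tf j (!₂[p 0, p 1, Real.cos (Complex.arg v) * p 2 - Real.sin (Complex.arg v) * p 3,
          Real.sin (Complex.arg v) * p 2 + Real.cos (Complex.arg v) * p 3]) = Tf j p := by
        have hs : ∑ l, (m l : ℝ) * Λ j l (!₂[p 0, p 1, Real.cos (Complex.arg v) * p 2 -
            Real.sin (Complex.arg v) * p 3, Real.sin (Complex.arg v) * p 2 + Real.cos (Complex.arg v) * p 3]) =
            ∑ l, (m l : ℝ) * Λ j l p :=
          Finset.sum_congr rfl fun l _ => by rw [hΛinv j l _ p (hW'W hp) (hW'W (hW'rot _ p hp))]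
        simp only [hTf, hs]
        simp
      rw [hrot, hΘtube j _ (hW'rot _ p hp), hΘtube j p hp, hT]
    · have hty' : ¬ ∃ j p, p ∈ W' ∧ h j p = fibreRot (fun _ => v) y := by
        rintro ⟨j, p, hp, he⟩
        apply hty
        refine ⟨j, !₂[p 0, p 1, Real.cos (-Complex.arg v) * p 2 - Real.sin (-Complex.arg v) * p 3,
          Real.sin (-Complex.arg v) * p 2 + Real.cos (-Complex.arg v) * p 3], hW'rot _ p hp, ?_⟩
        rw [hequiv j _ p (hW'W hp), he, fibreRot_fibreRot]
        refine fibreRot_of_apply_eq_one ?_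
        show v * Complex.exp (((-Complex.arg v : ℝ) : ℂ) * Complex.I) = 1
        nth_rewrite 1 [← hvexp]
        rw [← Complex.exp_add]
        convert Complex.exp_zero using 2
        push_cast
        ring
      rw [hΘnot _ hty', hΘnot _ hty]
      simp only [hBal, zC_fibreRot]
  · -- the identity on the ball
    intro y hy hyρ
    have hy' : dist y c < 3 * a / 2 := lt_of_le_of_lt hyρ hρ
    rw [hΘball y hy']
    exact hidBal y hy'
  · -- the identity along the tubes
    intro j p hp hN
    rw [hΘtube' j p hp hN]
    exact hidTf j p hp


end ModelHandles

/-- **Registered piece `helper_handlebodyChart_modelHandles_phaseOfLifts` of the model lemma M3 (part 3 of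
the data stub: phase data from lifts of the angles about the holes)**: for base data and handle charts with
the static properties of the data stub, equivariant under the rotations of the `(p₂, p₃)`-plane, and smooth
invariant lifts `Λ_l^j` of `arg(z(h j p) - c_l)` along the tubes with the prescribed end values (ball branch,
plus `2π` on the end `p₀ > 0` when `l = j`), the phase clause of the data stub holds, with `ε = m`
(`ModelHandles.phase_of_lifts`). [folklore] -/
theorem helper_handlebodyChart_modelHandles_phaseOfLifts : ∀ (k : ℕ) (c : EuclideanSpace ℝ (Fin 4)) (a : ℝ) (W : Set (EuclideanSpace ℝ (Fin 4))) (h : Fin k → EuclideanSpace ℝ (Fin 4) → EuclideanSpace ℝ (Fin 4)), (0 < a ∧ Metric.closedBall c (3 * a / 2) ⊆ Literature.Topology.FourManifolds.MMSW.modelHandlebody k ∧ IsOpen W ∧ {p : EuclideanSpace ℝ (Fin 4) | |p 0| ≤ 1 ∧ (p 1) ^ 2 + (p 2) ^ 2 + (p 3) ^ 2 ≤ 1} ⊆ W ∧ (∀ j, ContDiffOn ℝ ((⊤ : ℕ∞) : WithTop ℕ∞) (h j) W ∧ Set.InjOn (h j) W ∧ (∀ p ∈ W, Function.Injective (fderiv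 ℝ (h j) p)) ∧ Set.MapsTo (h j) W (Literature.Topology.FourManifolds.MMSW.modelHandlebody k)) ∧ (∀ j l, j ≠ l → ∀ p ∈ W, ∀ q ∈ W, h j p ≠ h l q) ∧ (∀ j, ∀ p ∈ W, 1 / 2 ≤ |p 0| → dist (h j p) c = a * (2 - |p 0|)) ∧ (∀ j, ∀ p ∈ W, |p 0| ≤ 1 / 2 → 3 * a / 2 ≤ dist (h j p) c)) → (∀ j (β : ℝ), ∀ p ∈ W, h j (!₂[p 0, p 1, Real.cos β * p 2 - Real.sin β * p 3, Real.sin β * p 2 + Real.cos β * p 3]) = Literature.Topology.FourManifolds.MMSW.fibreRot (fun _ => Complex.exp ((β : ℂ) * Complex.I)) (h j p)) → (∀ j l, ∃ Λ : EuclideanSpace ℝ (Fin 4) → ℝ, ContDiffOn ℝ ((⊤ : ℕ∞) : WithTop ℕ∞) Λ W ∧ (∀ p ∈ W, Complex.exp ((Λ p : ℂ) * Complex.I) = (Literature.AlgebraicTopology.Homotopy.HopfFibration.zC (h j p) - Literature.Topology.FourManifolds.MMSW.holeCentre k l) / (((‖Literature.AlgebraicTopology.Homotopy.HopfFibration.zC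 (h j p) - Literature.Topology.FourManifolds.MMSW.holeCentre k l‖ : ℝ)) : ℂ)) ∧ (∀ (β : ℝ), ∀ p ∈ W, !₂[p 0, p 1, Real.cos β * p 2 - Real.sin β * p 3, Real.sin β * p 2 + Real.cos β * p 3] ∈ W → Λ (!₂[p 0, p 1, Real.cos β * p 2 - Real.sin β * p 3, Real.sin β * p 2 + Real.cos β * p 3]) = Λ p) ∧ (∀ p ∈ W, 1 / 2 ≤ |p 0| → Λ p = Complex.arg ((Literature.AlgebraicTopology.Homotopy.HopfFibration.zC (h j p) - Literature.Topology.FourManifolds.MMSW.holeCentre k l) * (starRingEnd ℂ) (Literature.AlgebraicTopology.Homotopy.HopfFibration.zC c - Literature.Topology.FourManifolds.MMSW.holeCentre k l)) + Complex.arg (Literature.AlgebraicTopology.Homotopy.HopfFibration.zC c - Literature.Topology.FourManifolds.MMSW.holeCentre k l) + (if j = l ∧ 0 < p 0 then 2 * Real.pi else 0))) → (∀ (m : Fin k → ℤ) (ρ : ℝ), ρ < 3 * a / 2 → ∃ (ε : Fin k → ℤ) (N' : Set (EuclideanSpace ℝ (Fin 4))) (Θ : EuclideanSpace ℝ (Fin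 4) → ℝ), IsOpen N' ∧ Metric.closedBall c ρ ⊆ N' ∧ (∀ j, h j '' {p : EuclideanSpace ℝ (Fin 4) | |p 0| ≤ 1 ∧ (p 1) ^ 2 + (p 2) ^ 2 + (p 3) ^ 2 ≤ 1} ⊆ N') ∧ ContDiffOn ℝ ((⊤ : ℕ∞) : WithTop ℕ∞) Θ N' ∧ (∀ v : ℂ, ‖v‖ = 1 → ∀ y ∈ N', Θ (Literature.Topology.FourManifolds.MMSW.fibreRot (fun _ => v) y) = Θ y) ∧ (∀ y ∈ N', dist y c ≤ ρ → Complex.exp ((Θ y : ℂ) * Complex.I) * ∏ l : Fin k, ((Literature.AlgebraicTopology.Homotopy.HopfFibration.zC y - Literature.Topology.FourManifolds.MMSW.holeCentre k l) / (((‖Literature.AlgebraicTopology.Homotopy.HopfFibration.zC y - Literature.Topology.FourManifolds.MMSW.holeCentre k l‖ : ℝ)) : ℂ)) ^ (ε l) = 1) ∧ (∀ j, ∀ p ∈ W, h j p ∈ N' → Complex.exp ((Θ (h j p) : ℂ) * Complex.I) * ∏ l : Fin k, ((Literature.AlgebraicTopology.Homotopy.HopfFibration.zC (h j p) - Literature.Topology.FourManifolds.MMSW.holeCentre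 k l) / (((‖Literature.AlgebraicTopology.Homotopy.HopfFibration.zC (h j p) - Literature.Topology.FourManifolds.MMSW.holeCentre k l‖ : ℝ)) : ℂ)) ^ (ε l) = Complex.exp (((2 * Real.pi * (m j : ℝ) * Real.smoothTransition (p 0 + 1 / 2) : ℝ) : ℂ) * Complex.I))) :=
  fun k c a W h hst heq hl => ModelHandles.phase_of_lifts k c a W h hst.1 hst.2.1 hst.2.2.1 hst.2.2.2.1
    hst.2.2.2.2.1 hst.2.2.2.2.2.1 hst.2.2.2.2.2.2.2 heq hl

end Summit.SmoothPoincare4.SmoothPoincare4.Theorems.DcrGap.MkFriends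

end
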